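import Literature.Analysis.Matrix.FiniteRangeDecompositionQuasi1D
import HarnessLib

/-!
# Finite-range decomposition with smoother pieces, VI: volume-uniform gradient bounds in the
# quasi-one-dimensional regime

`Literature/Analysis/Matrix/`; assembles parts IV–V (`FiniteRangeDecompositionQuasi1DPointwise.lean`,
`FiniteRangeDecompositionQuasi1D.lean`) into the volume-uniform gradient bounds for the power-`m`
pieces `C^{(m)}_N = frdPiecePow A m N` of the dyadic finite-range decomposition on the abstract
three-dimensional torus (`G`, steps `e₀,e₁,e₂` of orders dividing `L₀,L₁,L₂` determining the
characters, `|G| ≥ L₀L₁L₂`, translation-invariant symmetric `A ≤ 4` with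
`c₀ Σ_i (2 − 2Re ψ(e_i)) ≤ σ_A(ψ)`) in the **quasi-one-dimensional regime `L₀ = L₁ = L ≤ 2^N ≤ L₂`**
(anisotropic space-time torus `(ℤ/L)² × ℤ/M`), for lists `l` of `k` steps with `k + 2 ≤ 2m`:

* `avg_gradSymbol_frdPiecePow_le_quasi1D_spatial`, `abs_rowDiffs_frdPiecePow_apply_le_quasi1D_spatial`
  (**differences with a spatial step are suppressed beyond the spatial size**):
  `|∇_l C^{(m)}_N(x,y)| ≤ K₁ (L/2^N)^{2m}/L^{k+1}`, `K₁ = 27m(2π)^kπ^{2m+2}2^{k+4}/(4(16c₀)^{m+1})`;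
* `avg_gradSymbol_frdPiecePow_le_quasi1D_temporal`, `abs_rowDiffs_frdPiecePow_apply_le_quasi1D_temporal`
  (**purely temporal differences scale one-dimensionally with the prefactor `1/L²`**):
  `|∇_l C^{(m)}_N(x,y)| ≤ K₂ 2^N/((2^N)^k L²)`, `K₂ = (27m(2π)^k/4)(1 + 5·2^{k+2}π^{2m+2}/(16c₀)^{m+1})`.

So at scales beyond `L` the scale-`N` fluctuation field is, up to `O((L/2^N)^{2m})`, constant on
each time slice, and its temporal increments have variance `O(2^{−N(k−1)}/L²)` per scale
(`k = 2`: `O(1/(2^N L²))`, summable in `N`) — the Gaussian input of the one-dimensional last stage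
of a multiscale expansion on an anisotropic torus.  All [folklore]; the exponents are the
`d_eff = 1` rows of the scaling table of [cite: Bauerschmidt2013, (1.10)].
-/

noncomputable section

open Finset Real
open Literature.Analysis.Fourier Literature.Analysis.Fourier.TrigApprox

namespace Literature.Analysis.Matrix

variable {G : Type*} [AddCommGroup G] [Fintype G] [DecidableEq G]

section Averages

variable {A : _root_.Matrix G G ℝ}

/-- **Quasi-1D volume-uniform bound for differences with a spatial step.**  In the regime
`L₀ = L₁ = L ≤ 2^N ≤ L₂`, for a list `l` of `k` steps among `±e_i` containing at least one of
`±e₀, ±e₁`, with `k + 2 ≤ 2m`: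
`|G|⁻¹ Σ_ψ (Π_{g∈l}‖ψ(g) − 1‖) σ_{C^{(m)}_N}(ψ) ≤ K₁(m,k,c₀) · (L/2^N)^{2m} / L^{k+1}`.
[cite: Bauerschmidt2013, (1.10) (the exponents in `d_eff = 1`)] -/
theorem avg_gradSymbol_frdPiecePow_le_quasi1D_spatial
    (e : Fin 3 → G) (Ls : Fin 3 → ℕ) (hL : ∀ i, Ls i ≠ 0) (he : ∀ i, Ls i • e i = 0)
    (hgen : ∀ ψ φ : AddChar G ℂ, (∀ i, ψ (e i) = φ (e i)) → ψ = φ)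
    (hcard : ∏ i, (Ls i : ℝ) ≤ Fintype.card G) (hL01 : Ls 1 = Ls 0)
    (hA : IsTranslationInvariant A) (hs : A.IsHermitian) (h0 : A.PosSemidef)
    (h4 : ((4 : ℝ) • (1 : _root_.Matrix G G ℝ) - A).PosSemidef)
    {c₀ : ℝ} (hc₀ : 0 < c₀)
    (hcoer : ∀ ψ : AddChar G ℂ, c₀ * ∑ i, (2 - 2 * (ψ (e i)).re) ≤ (symbol A ψ).re)
    (m N : ℕ) (hLT : Ls 0 ≤ 2 ^ N) (hTM : 2 ^ N ≤ Ls 2)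
    (l : List G) (hl : ∀ g ∈ l, ∃ i, g = e i ∨ g = -e i)
    (hspat : ∃ g ∈ l, g = e 0 ∨ g = -e 0 ∨ g = e 1 ∨ g = -e 1) (hkm : l.length + 2 ≤ 2 * m) :
    (Fintype.card G : ℝ)⁻¹ * ∑ ψ : AddChar G ℂ,
        (l.map fun g => ‖ψ g - 1‖).prod * (symbol (frdPiecePow A m N) ψ).re
      ≤ 27 * m * (2 * π) ^ l.length * π ^ (2 * m + 2) * 2 ^ (l.length + 4) / (4 * (16 * c₀) ^ (m + 1))
          * ((Ls 0 : ℝ) / 2 ^ N) ^ (2 * m) / (Ls 0 : ℝ) ^ (l.length + 1) := by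
  classical
  set k := l.length with hk
  set J := Nat.log 2 (Ls 0) + 1 with hJ
  set B : ℕ → ℝ := fun j => (2 * π * 2 ^ (j + 1) / (Ls 0 : ℝ)) ^ k
      * (m * π ^ (2 * m + 2) / (4 * ((2 : ℝ) ^ N) ^ (2 * m))
        * (((Ls 0 : ℝ)) ^ 2 / (16 * c₀ * ((2 : ℝ) ^ j) ^ 2)) ^ (m + 1)) with hB
  set cnt : ℕ → ℝ := fun j => ((Finset.univ.filter fun ψ : AddChar G ℂ =>
      ∀ i, |addCharMomentum (Ls i) (e i) ψ| < 2 ^ (j + 1) / (Ls 0 : ℝ)).card : ℝ) with hcnt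
  have hB0 : ∀ j, 0 ≤ B j := fun j => by rw [hB]; positivity
  -- pointwise
  have hpt : ∀ ψ : AddChar G ℂ, (l.map fun g => ‖ψ g - 1‖).prod * (symbol (frdPiecePow A m N) ψ).re
      ≤ ∑ j ∈ Finset.range J, B j
        * (if ∀ i, |addCharMomentum (Ls i) (e i) ψ| < 2 ^ (j + 1) / (Ls 0 : ℝ) then (1 : ℝ) else 0) := by
    intro ψ
    by_cases hZ : addCharIndex (Ls 0) (e 0) ψ = 0 ∧ addCharIndex (Ls 1) (e 1) ψ = 0
    · rw [prod_norm_addChar_sub_one_eq_zero_of_spatial e Ls hL he ψ hZ l hspat, zero_mul]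
      exact Finset.sum_nonneg fun j _ => mul_nonneg (hB0 j) (by split_ifs <;> norm_num)
    · have hψ : addCharIndex (Ls 0) (e 0) ψ ≠ 0 ∨ addCharIndex (Ls 1) (e 1) ψ ≠ 0 := by tauto
      exact gradSymbol_frdPiecePow_le_shells_offZero e Ls hL he hL01 hA hs h0 h4 hc₀ hcoer m N ψ hψ l hl
  -- sum over `ψ`
  have hsum : ∑ ψ : AddChar G ℂ, (l.map fun g => ‖ψ g - 1‖).prod * (symbol (frdPiecePow A m N) ψ).re
      ≤ ∑ j ∈ Finset.range J, B j * cnt j := by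
    refine (Finset.sum_le_sum fun ψ _ => hpt ψ).trans (le_of_eq ?_)
    rw [Finset.sum_comm]
    refine Finset.sum_congr rfl fun j _ => ?_
    rw [← Finset.mul_sum, Finset.sum_boole]
  calc (Fintype.card G : ℝ)⁻¹ * ∑ ψ : AddChar G ℂ,
          (l.map fun g => ‖ψ g - 1‖).prod * (symbol (frdPiecePow A m N) ψ).re
      ≤ (Fintype.card G : ℝ)⁻¹ * ∑ j ∈ Finset.range J, B j * cnt j := by gcongr
    _ = ∑ j ∈ Finset.range J, B j * ((Fintype.card G : ℝ)⁻¹ * cnt j) := by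
        rw [Finset.mul_sum]; exact Finset.sum_congr rfl fun j _ => by ring
    _ ≤ _ := offZero_shellSum_le e Ls hL he hgen hcard hL01 hc₀ hkm N hLT hTM J

/-- **Quasi-1D volume-uniform bound for purely temporal differences.**  In the regime
`L₀ = L₁ = L ≤ 2^N ≤ L₂`, for a list `l` of `k` steps among `±e₂` with `k + 2 ≤ 2m`:
`|G|⁻¹ Σ_ψ (Π_{g∈l}‖ψ(g) − 1‖) σ_{C^{(m)}_N}(ψ) ≤ K₂(m,k,c₀) · 2^N / ((2^N)^k L²)`,
`K₂ = (27m(2π)^k/4)(1 + 5·2^{k+2}π^{2m+2}/(16c₀)^{m+1})`.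
[cite: Bauerschmidt2013, (1.10) (the exponents in `d_eff = 1`)] -/
theorem avg_gradSymbol_frdPiecePow_le_quasi1D_temporal
    (e : Fin 3 → G) (Ls : Fin 3 → ℕ) (hL : ∀ i, Ls i ≠ 0) (he : ∀ i, Ls i • e i = 0)
    (hgen : ∀ ψ φ : AddChar G ℂ, (∀ i, ψ (e i) = φ (e i)) → ψ = φ)
    (hcard : ∏ i, (Ls i : ℝ) ≤ Fintype.card G) (hL01 : Ls 1 = Ls 0)
    (hA : IsTranslationInvariant A) (hs : A.IsHermitian) (h0 : A.PosSemidef)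
    (h4 : ((4 : ℝ) • (1 : _root_.Matrix G G ℝ) - A).PosSemidef)
    {c₀ : ℝ} (hc₀ : 0 < c₀)
    (hcoer : ∀ ψ : AddChar G ℂ, c₀ * ∑ i, (2 - 2 * (ψ (e i)).re) ≤ (symbol A ψ).re)
    (m N : ℕ) (hLT : Ls 0 ≤ 2 ^ N) (hTM : 2 ^ N ≤ Ls 2)
    (l : List G) (htemp : ∀ g ∈ l, g = e 2 ∨ g = -e 2) (hkm : l.length + 2 ≤ 2 * m) :
    (Fintype.card G : ℝ)⁻¹ * ∑ ψ : AddChar G ℂ,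
        (l.map fun g => ‖ψ g - 1‖).prod * (symbol (frdPiecePow A m N) ψ).re
      ≤ 27 * m * (2 * π) ^ l.length / 4
          * (1 + 5 * 2 ^ (l.length + 2) * π ^ (2 * m + 2) / (16 * c₀) ^ (m + 1))
          * 2 ^ N / (((2 : ℝ) ^ N) ^ l.length * (Ls 0 : ℝ) ^ 2) := by
  classical
  set k := l.length with hk
  have hLpos : (0 : ℝ) < (Ls 0 : ℝ) := Nat.cast_pos.mpr (Nat.pos_of_ne_zero (hL 0))
  have hTpos : (0 : ℝ) < (2 : ℝ) ^ N := by positivity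
  have hLT' : (Ls 0 : ℝ) ≤ (2 : ℝ) ^ N := by exact_mod_cast hLT
  have hl : ∀ g ∈ l, ∃ i, g = e i ∨ g = -e i := fun g hg => ⟨2, htemp g hg⟩
  set J := Nat.log 2 (Ls 0) + 1 with hJ
  -- the three families of weights
  set Bn : ℕ → ℝ := fun j => (2 * π * 2 ^ (j + 1) / (Ls 0 : ℝ)) ^ k
      * (m * π ^ (2 * m + 2) / (4 * ((2 : ℝ) ^ N) ^ (2 * m))
        * (((Ls 0 : ℝ)) ^ 2 / (16 * c₀ * ((2 : ℝ) ^ j) ^ 2)) ^ (m + 1)) with hBn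
  set X0 : ℝ := (2 * π / 2 ^ N) ^ k * (m * ((2 : ℝ) ^ N) ^ 2 / 4) with hX0
  set Bz : ℕ → ℝ := fun j => (2 * π * 2 ^ (j + 1) / 2 ^ N) ^ k
      * (m * π ^ (2 * m + 2) / (4 * ((2 : ℝ) ^ N) ^ (2 * m))
        * (((2 : ℝ) ^ N) ^ 2 / (16 * c₀ * ((2 : ℝ) ^ j) ^ 2)) ^ (m + 1)) with hBz
  -- the three families of indicators
  set In : ℕ → AddChar G ℂ → Prop := fun j ψ =>
    ∀ i, |addCharMomentum (Ls i) (e i) ψ| < 2 ^ (j + 1) / (Ls 0 : ℝ) with hIn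
  set Zc : AddChar G ℂ → Prop := fun ψ => addCharIndex (Ls 0) (e 0) ψ = 0 ∧
      addCharIndex (Ls 1) (e 1) ψ = 0 ∧ |addCharMomentum (Ls 2) (e 2) ψ| < 1 / 2 ^ N with hZc
  set Zs : ℕ → AddChar G ℂ → Prop := fun j ψ => addCharIndex (Ls 0) (e 0) ψ = 0 ∧
      addCharIndex (Ls 1) (e 1) ψ = 0 ∧ |addCharMomentum (Ls 2) (e 2) ψ| < 2 ^ (j + 1) / 2 ^ N with hZs
  have hBn0 : ∀ j, 0 ≤ Bn j := fun j => by rw [hBn]; positivity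
  have hX00 : 0 ≤ X0 := by rw [hX0]; positivity
  have hBz0 : ∀ j, 0 ≤ Bz j := fun j => by rw [hBz]; positivity
  have hind0 : ∀ (p : Prop) [Decidable p], (0 : ℝ) ≤ if p then 1 else 0 := by
    intro p _; split_ifs <;> norm_num
  -- pointwise, with the zero-mode condition inside the indicators
  have hpt : ∀ ψ : AddChar G ℂ, (l.map fun g => ‖ψ g - 1‖).prod * (symbol (frdPiecePow A m N) ψ).re
      ≤ (∑ j ∈ Finset.range J, Bn j * (if In j ψ then (1 : ℝ) else 0))
        + (X0 * (if Zc ψ then (1 : ℝ) else 0)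
          + ∑ j ∈ Finset.range N, Bz j * (if Zs j ψ then (1 : ℝ) else 0)) := by
    intro ψ
    have hn0 : 0 ≤ ∑ j ∈ Finset.range J, Bn j * (if In j ψ then (1 : ℝ) else 0) :=
      Finset.sum_nonneg fun j _ => mul_nonneg (hBn0 j) (hind0 _)
    have hz0 : 0 ≤ X0 * (if Zc ψ then (1 : ℝ) else 0)
        + ∑ j ∈ Finset.range N, Bz j * (if Zs j ψ then (1 : ℝ) else 0) :=
      add_nonneg (mul_nonneg hX00 (hind0 _))
        (Finset.sum_nonneg fun j _ => mul_nonneg (hBz0 j) (hind0 _))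
    by_cases hZ : addCharIndex (Ls 0) (e 0) ψ = 0 ∧ addCharIndex (Ls 1) (e 1) ψ = 0
    · have h := gradSymbol_frdPiecePow_le_shells_zeroMode e Ls hL he hA hs h0 h4 hc₀ hcoer m N ψ hZ l htemp
      have hZc' : (X0 * if Zc ψ then (1 : ℝ) else 0)
          = X0 * (if |addCharMomentum (Ls 2) (e 2) ψ| < 1 / 2 ^ N then (1 : ℝ) else 0) := by
        simp only [hZc, hZ, true_and]
      have hZs' : ∑ j ∈ Finset.range N, Bz j * (if Zs j ψ then (1 : ℝ) else 0)
          = ∑ j ∈ Finset.range N, Bz j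
              * (if |addCharMomentum (Ls 2) (e 2) ψ| < 2 ^ (j + 1) / 2 ^ N then (1 : ℝ) else 0) := by
        refine Finset.sum_congr rfl fun j _ => ?_
        simp only [hZs, hZ, true_and]
      rw [hZc', hZs']
      rw [hBz, hX0] at *
      linarith
    · have hψ : addCharIndex (Ls 0) (e 0) ψ ≠ 0 ∨ addCharIndex (Ls 1) (e 1) ψ ≠ 0 := by tauto
      have h := gradSymbol_frdPiecePow_le_shells_offZero e Ls hL he hL01 hA hs h0 h4 hc₀ hcoer m N ψ hψ l hl
      rw [hBn, hIn] at *
      linarith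
  -- sum over `ψ`
  set cn : ℕ → ℝ := fun j => ((Finset.univ.filter fun ψ : AddChar G ℂ => In j ψ).card : ℝ) with hcn
  set cz0 : ℝ := ((Finset.univ.filter fun ψ : AddChar G ℂ => Zc ψ).card : ℝ) with hcz0
  set cz : ℕ → ℝ := fun j => ((Finset.univ.filter fun ψ : AddChar G ℂ => Zs j ψ).card : ℝ) with hcz
  have hsumA : ∑ ψ : AddChar G ℂ, ∑ j ∈ Finset.range J, Bn j * (if In j ψ then (1 : ℝ) else 0)
      = ∑ j ∈ Finset.range J, Bn j * cn j := by
    rw [Finset.sum_comm]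
    refine Finset.sum_congr rfl fun j _ => ?_
    rw [← Finset.mul_sum, Finset.sum_boole]
  have hsumB : ∑ ψ : AddChar G ℂ, X0 * (if Zc ψ then (1 : ℝ) else 0) = X0 * cz0 := by
    rw [← Finset.mul_sum, Finset.sum_boole]
  have hsumC : ∑ ψ : AddChar G ℂ, ∑ j ∈ Finset.range N, Bz j * (if Zs j ψ then (1 : ℝ) else 0)
      = ∑ j ∈ Finset.range N, Bz j * cz j := by
    rw [Finset.sum_comm]
    refine Finset.sum_congr rfl fun j _ => ?_
    rw [← Finset.mul_sum, Finset.sum_boole]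
  have hsum : ∑ ψ : AddChar G ℂ, (l.map fun g => ‖ψ g - 1‖).prod * (symbol (frdPiecePow A m N) ψ).re
      ≤ (∑ j ∈ Finset.range J, Bn j * cn j) + (X0 * cz0 + ∑ j ∈ Finset.range N, Bz j * cz j) := by
    refine (Finset.sum_le_sum fun ψ _ => hpt ψ).trans (le_of_eq ?_)
    rw [Finset.sum_add_distrib, Finset.sum_add_distrib, hsumA, hsumB, hsumC]
  -- constants
  set C₁ : ℝ := 27 * m * (2 * π) ^ k * π ^ (2 * m + 2) * 2 ^ (k + 3) / (4 * (16 * c₀) ^ (m + 1)) with hC₁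
  have hC₁0 : 0 ≤ C₁ := by rw [hC₁]; positivity
  set U : ℝ := (2 : ℝ) ^ N / (((2 : ℝ) ^ N) ^ k * (Ls 0 : ℝ) ^ 2) with hU
  have hU0 : 0 ≤ U := by rw [hU]; positivity
  -- (1) the off-zero-mode family
  have h1 : ∑ j ∈ Finset.range J, Bn j * ((Fintype.card G : ℝ)⁻¹ * cn j) ≤ 2 * C₁ * U := by
    have h := offZero_shellSum_le e Ls hL he hgen hcard hL01 hc₀ hkm N hLT hTM J
    refine h.trans ?_
    -- `(L/T)^{2m}/L^{k+1} ≤ T/(T^k L²)`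
    have hkey : ((Ls 0 : ℝ) / 2 ^ N) ^ (2 * m) / (Ls 0 : ℝ) ^ (k + 1) ≤ U := by
      rw [hU, div_pow, div_div, div_le_div_iff₀ (by positivity) (by positivity)]
      obtain ⟨d, hd⟩ : ∃ d, 2 * m = k + 1 + d := ⟨2 * m - (k + 1), by omega⟩
      have hLd : (Ls 0 : ℝ) ^ d ≤ ((2 : ℝ) ^ N) ^ d := pow_le_pow_left₀ hLpos.le hLT' d
      calc (Ls 0 : ℝ) ^ (2 * m) * (((2 : ℝ) ^ N) ^ k * (Ls 0 : ℝ) ^ 2)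
          = (Ls 0 : ℝ) ^ (k + 1) * (((2 : ℝ) ^ N) ^ k * (Ls 0 : ℝ) ^ 2) * (Ls 0 : ℝ) ^ d := by
            rw [hd]; ring
        _ ≤ (Ls 0 : ℝ) ^ (k + 1) * (((2 : ℝ) ^ N) ^ k * (Ls 0 : ℝ) ^ 2) * ((2 : ℝ) ^ N) ^ d := by gcongr
        _ ≤ (Ls 0 : ℝ) ^ (k + 1) * (((2 : ℝ) ^ N) ^ k * ((2 : ℝ) ^ N) ^ 2) * ((2 : ℝ) ^ N) ^ d := by
            gcongr
        _ = (2 : ℝ) ^ N * (((2 : ℝ) ^ N) ^ (2 * m) * (Ls 0 : ℝ) ^ (k + 1)) := by rw [hd]; ring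
    calc 27 * m * (2 * π) ^ k * π ^ (2 * m + 2) * 2 ^ (k + 4) / (4 * (16 * c₀) ^ (m + 1))
          * ((Ls 0 : ℝ) / 2 ^ N) ^ (2 * m) / (Ls 0 : ℝ) ^ (k + 1)
        = 2 * C₁ * (((Ls 0 : ℝ) / 2 ^ N) ^ (2 * m) / (Ls 0 : ℝ) ^ (k + 1)) := by
          rw [hC₁, show (2 : ℝ) ^ (k + 4) = 2 ^ (k + 3) * 2 by ring]; ring
      _ ≤ 2 * C₁ * U := mul_le_mul_of_nonneg_left hkey (by positivity)
  -- (2) the zero-mode cube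
  have hT2 : 1 / (Ls 2 : ℝ) ≤ 1 / (2 : ℝ) ^ N := by
    have : (2 : ℝ) ^ N ≤ (Ls 2 : ℝ) := by exact_mod_cast hTM
    exact one_div_le_one_div_of_le hTpos this
  have h2 : X0 * ((Fintype.card G : ℝ)⁻¹ * cz0) ≤ 27 * m * (2 * π) ^ k / 4 * U := by
    have hc := inv_card_mul_card_zeroMode_le e Ls hL he hgen hcard hL01 (ρ := 1 / (2 : ℝ) ^ N) hT2
    calc X0 * ((Fintype.card G : ℝ)⁻¹ * cz0) ≤ X0 * (27 * (1 / (2 : ℝ) ^ N) / (Ls 0 : ℝ) ^ 2) :=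
          mul_le_mul_of_nonneg_left hc hX00
      _ = 27 * m * (2 * π) ^ k / 4 * U := by
          have hTk : ((2 : ℝ) ^ N) ^ k ≠ 0 := pow_ne_zero _ hTpos.ne'
          have hL2 : (Ls 0 : ℝ) ^ 2 ≠ 0 := pow_ne_zero _ hLpos.ne'
          rw [hX0, hU, div_pow]
          field_simp
  -- (3) the zero-mode shells
  have h3 : ∑ j ∈ Finset.range N, Bz j * ((Fintype.card G : ℝ)⁻¹ * cz j) ≤ C₁ / 2 * U := by
    have hterm : ∀ j, Bz j * ((Fintype.card G : ℝ)⁻¹ * cz j) ≤ C₁ / 4 * (1 / 2) ^ j * U := by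
      intro j
      have hρ : 1 / (Ls 2 : ℝ) ≤ 2 ^ (j + 1) / (2 : ℝ) ^ N := by
        refine hT2.trans ?_
        rw [div_le_div_iff_of_pos_right hTpos]
        exact one_le_pow₀ (by norm_num)
      have hc := inv_card_mul_card_zeroMode_le e Ls hL he hgen hcard hL01 hρ
      have hshell := shellTerm_le hc₀ hTpos hkm j
      -- `27·2^{j+1}/(T L²) = (3·2^{j+1}/T)³ · T²/(L²·4^{j+1})`
      have hsplit : (27 * (2 ^ (j + 1) / (2 : ℝ) ^ N) / (Ls 0 : ℝ) ^ 2 : ℝ)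
          = (3 * (2 ^ (j + 1) / (2 : ℝ) ^ N)) ^ 3 * (((2 : ℝ) ^ N) ^ 2 / ((Ls 0 : ℝ) ^ 2 * 4 ^ (j + 1))) := by
        have h4 : (4 : ℝ) ^ (j + 1) = 2 ^ (j + 1) * 2 ^ (j + 1) := by
          rw [show (4 : ℝ) = 2 * 2 by norm_num, mul_pow]
        have h2j : (2 : ℝ) ^ (j + 1) ≠ 0 := pow_ne_zero _ two_ne_zero
        have hL2 : (Ls 0 : ℝ) ^ 2 ≠ 0 := pow_ne_zero _ hLpos.ne'
        have hT0 : (2 : ℝ) ^ N ≠ 0 := hTpos.ne'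
        rw [h4]
        field_simp
        ring
      calc Bz j * ((Fintype.card G : ℝ)⁻¹ * cz j) ≤ Bz j * (27 * (2 ^ (j + 1) / (2 : ℝ) ^ N) / (Ls 0 : ℝ) ^ 2) :=
            mul_le_mul_of_nonneg_left hc (hBz0 j)
        _ = (Bz j * (3 * (2 ^ (j + 1) / (2 : ℝ) ^ N)) ^ 3)
              * (((2 : ℝ) ^ N) ^ 2 / ((Ls 0 : ℝ) ^ 2 * 4 ^ (j + 1))) := by
            rw [hsplit]; ring
        _ ≤ (C₁ * (1 / 2) ^ j / ((2 : ℝ) ^ N) ^ (k + 1))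
              * (((2 : ℝ) ^ N) ^ 2 / ((Ls 0 : ℝ) ^ 2 * 4 ^ (j + 1))) := by
            refine mul_le_mul_of_nonneg_right ?_ (by positivity)
            rw [hBz, hC₁]; exact hshell
        _ = C₁ / 4 * (1 / 2) ^ j * U * (1 / 4) ^ j := by
            have hTk : ((2 : ℝ) ^ N) ^ k ≠ 0 := pow_ne_zero _ hTpos.ne'
            have hT0 : (2 : ℝ) ^ N ≠ 0 := hTpos.ne'
            have h4j : (4 : ℝ) ^ j ≠ 0 := pow_ne_zero _ (by norm_num)
            have hL2 : (Ls 0 : ℝ) ^ 2 ≠ 0 := pow_ne_zero _ hLpos.ne'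
            rw [hU, show ((2 : ℝ) ^ N) ^ (k + 1) = ((2 : ℝ) ^ N) ^ k * 2 ^ N by ring,
              show (4 : ℝ) ^ (j + 1) = 4 ^ j * 4 by ring, one_div_pow, one_div_pow]
            field_simp
        _ ≤ C₁ / 4 * (1 / 2) ^ j * U * 1 := by
            refine mul_le_mul_of_nonneg_left (pow_le_one₀ (by norm_num) (by norm_num)) (by positivity)
        _ = C₁ / 4 * (1 / 2) ^ j * U := mul_one _
    calc ∑ j ∈ Finset.range N, Bz j * ((Fintype.card G : ℝ)⁻¹ * cz j)
        ≤ ∑ j ∈ Finset.range N, C₁ / 4 * (1 / 2) ^ j * U := Finset.sum_le_sum fun j _ => hterm j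
      _ = C₁ / 4 * U * ∑ j ∈ Finset.range N, (1 / 2 : ℝ) ^ j := by
          rw [Finset.mul_sum]; exact Finset.sum_congr rfl fun j _ => by ring
      _ ≤ C₁ / 4 * U * 2 := mul_le_mul_of_nonneg_left (sum_geometric_two_le N) (by positivity)
      _ = C₁ / 2 * U := by ring
  -- assemble
  calc (Fintype.card G : ℝ)⁻¹ * ∑ ψ : AddChar G ℂ,
          (l.map fun g => ‖ψ g - 1‖).prod * (symbol (frdPiecePow A m N) ψ).re
      ≤ (Fintype.card G : ℝ)⁻¹ * ((∑ j ∈ Finset.range J, Bn j * cn j)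
          + (X0 * cz0 + ∑ j ∈ Finset.range N, Bz j * cz j)) := by gcongr
    _ = (∑ j ∈ Finset.range J, Bn j * ((Fintype.card G : ℝ)⁻¹ * cn j))
          + (X0 * ((Fintype.card G : ℝ)⁻¹ * cz0)
            + ∑ j ∈ Finset.range N, Bz j * ((Fintype.card G : ℝ)⁻¹ * cz j)) := by
        rw [mul_add, mul_add, Finset.mul_sum, Finset.mul_sum]
        have eA : ∑ j ∈ Finset.range J, (Fintype.card G : ℝ)⁻¹ * (Bn j * cn j)
            = ∑ j ∈ Finset.range J, Bn j * ((Fintype.card G : ℝ)⁻¹ * cn j) :=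
          Finset.sum_congr rfl fun j _ => by ring
        have eC : ∑ j ∈ Finset.range N, (Fintype.card G : ℝ)⁻¹ * (Bz j * cz j)
            = ∑ j ∈ Finset.range N, Bz j * ((Fintype.card G : ℝ)⁻¹ * cz j) :=
          Finset.sum_congr rfl fun j _ => by ring
        rw [eA, eC]
        ring
    _ ≤ 2 * C₁ * U + (27 * m * (2 * π) ^ k / 4 * U + C₁ / 2 * U) := add_le_add h1 (add_le_add h2 h3)
    _ = 27 * m * (2 * π) ^ k / 4 * (1 + 5 * 2 ^ (k + 2) * π ^ (2 * m + 2) / (16 * c₀) ^ (m + 1))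
          * 2 ^ N / (((2 : ℝ) ^ N) ^ k * (Ls 0 : ℝ) ^ 2) := by
        have hTk : ((2 : ℝ) ^ N) ^ k ≠ 0 := pow_ne_zero _ hTpos.ne'
        have hL2 : (Ls 0 : ℝ) ^ 2 ≠ 0 := pow_ne_zero _ hLpos.ne'
        have hc16 : (16 * c₀) ^ (m + 1) ≠ 0 := pow_ne_zero _ (by positivity)
        rw [hU, hC₁, show (2 : ℝ) ^ (k + 3) = 2 ^ (k + 2) * 2 by ring]
        field_simp
        ring

/-- **Quasi-1D kernel bound, spatial differences**: `|∇_l C^{(m)}_N(x,y)| ≤ K₁ (L/2^N)^{2m}/L^{k+1}`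
when `l` contains a spatial step, `L₀ = L₁ = L ≤ 2^N ≤ L₂`, `k + 2 ≤ 2m`.
[cite: Bauerschmidt2013, (1.10) (the exponents in `d_eff = 1`)] -/
theorem abs_rowDiffs_frdPiecePow_apply_le_quasi1D_spatial
    (e : Fin 3 → G) (Ls : Fin 3 → ℕ) (hL : ∀ i, Ls i ≠ 0) (he : ∀ i, Ls i • e i = 0)
    (hgen : ∀ ψ φ : AddChar G ℂ, (∀ i, ψ (e i) = φ (e i)) → ψ = φ)
    (hcard : ∏ i, (Ls i : ℝ) ≤ Fintype.card G) (hL01 : Ls 1 = Ls 0)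
    (hA : IsTranslationInvariant A) (hs : A.IsHermitian) (h0 : A.PosSemidef)
    (h4 : ((4 : ℝ) • (1 : _root_.Matrix G G ℝ) - A).PosSemidef)
    {c₀ : ℝ} (hc₀ : 0 < c₀)
    (hcoer : ∀ ψ : AddChar G ℂ, c₀ * ∑ i, (2 - 2 * (ψ (e i)).re) ≤ (symbol A ψ).re)
    (m N : ℕ) (hLT : Ls 0 ≤ 2 ^ N) (hTM : 2 ^ N ≤ Ls 2)
    (l : List G) (hl : ∀ g ∈ l, ∃ i, g = e i ∨ g = -e i)
    (hspat : ∃ g ∈ l, g = e 0 ∨ g = -e 0 ∨ g = e 1 ∨ g = -e 1) (hkm : l.length + 2 ≤ 2 * m) (x y : G) :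
    |rowDiffs l (frdPiecePow A m N) x y|
      ≤ 27 * m * (2 * π) ^ l.length * π ^ (2 * m + 2) * 2 ^ (l.length + 4) / (4 * (16 * c₀) ^ (m + 1))
          * ((Ls 0 : ℝ) / 2 ^ N) ^ (2 * m) / (Ls 0 : ℝ) ^ (l.length + 1) :=
  (abs_rowDiffs_frdPiecePow_apply_le hA hs h0 h4 m N l x y).trans
    (avg_gradSymbol_frdPiecePow_le_quasi1D_spatial e Ls hL he hgen hcard hL01 hA hs h0 h4 hc₀ hcoer m N
      hLT hTM l hl hspat hkm)

/-- **Quasi-1D kernel bound, temporal differences**: `|∇_l C^{(m)}_N(x,y)| ≤ K₂ 2^N/((2^N)^k L²)`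
when every step of `l` is `±e₂`, `L₀ = L₁ = L ≤ 2^N ≤ L₂`, `k + 2 ≤ 2m`.
[cite: Bauerschmidt2013, (1.10) (the exponents in `d_eff = 1`)] -/
theorem abs_rowDiffs_frdPiecePow_apply_le_quasi1D_temporal
    (e : Fin 3 → G) (Ls : Fin 3 → ℕ) (hL : ∀ i, Ls i ≠ 0) (he : ∀ i, Ls i • e i = 0)
    (hgen : ∀ ψ φ : AddChar G ℂ, (∀ i, ψ (e i) = φ (e i)) → ψ = φ)
    (hcard : ∏ i, (Ls i : ℝ) ≤ Fintype.card G) (hL01 : Ls 1 = Ls 0)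
    (hA : IsTranslationInvariant A) (hs : A.IsHermitian) (h0 : A.PosSemidef)
    (h4 : ((4 : ℝ) • (1 : _root_.Matrix G G ℝ) - A).PosSemidef)
    {c₀ : ℝ} (hc₀ : 0 < c₀)
    (hcoer : ∀ ψ : AddChar G ℂ, c₀ * ∑ i, (2 - 2 * (ψ (e i)).re) ≤ (symbol A ψ).re)
    (m N : ℕ) (hLT : Ls 0 ≤ 2 ^ N) (hTM : 2 ^ N ≤ Ls 2)
    (l : List G) (htemp : ∀ g ∈ l, g = e 2 ∨ g = -e 2) (hkm : l.length + 2 ≤ 2 * m) (x y : G) :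
    |rowDiffs l (frdPiecePow A m N) x y|
      ≤ 27 * m * (2 * π) ^ l.length / 4
          * (1 + 5 * 2 ^ (l.length + 2) * π ^ (2 * m + 2) / (16 * c₀) ^ (m + 1))
          * 2 ^ N / (((2 : ℝ) ^ N) ^ l.length * (Ls 0 : ℝ) ^ 2) :=
  (abs_rowDiffs_frdPiecePow_apply_le hA hs h0 h4 m N l x y).trans
    (avg_gradSymbol_frdPiecePow_le_quasi1D_temporal e Ls hL he hgen hcard hL01 hA hs h0 h4 hc₀ hcoer m N
      hLT hTM l htemp hkm)

end Averages

end Literature.Analysis.Matrix
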